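import Summits.QuantumFields.BalabanUV.T4Continuum.Support.NE9AnalyticFixedPoint

/-!
# NE9Contraction113Banach — THE (1.13) FIXED POINT OF [II] p. 5, AS TYPED IN `B13Contraction113`, IS JOINTLY ANALYTIC IN
# (A′, H) AT ONCE: the universal solution map `D(A′, H)` on `ball 0 ε ×ˢ ball 0 b`, its (1.14) bound, its second-order vanishing
# at `A′ = 0`, and the corollary for ANY analytic parametrisation `ξ ↦ (A′_ξ, H_ξ)` (route R2′ «`cur` BY THREE DISPLAYED
# CONTRACTIONS» of `t4/ROUTES-NE9.md` v2 §L1.2, step B1⁺ ON THE PRINTED INSTANCE; cell `pub-balaban`, T4-DAG §2 node U3 ∕ §6 NE9;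
# unit `b2b-balaban-t4-ne9-formalise-leaf-03`, generation 38; Summits-side NEW work, nothing printed asserted)

HONEST FRAMING (T4-DAG PAGE 1).  Rung (B)+1 of the FINITE-VOLUME T⁴ programme — NOT infinite volume, NOT a mass gap, NOT
the Clay problem.  NE9 (`T4OutputRate.NE9` ∧ `FadingMemory`) is a cell NEW ESTIMATE, NOT PRINTED in [I] = CMP **109**, [II] =
CMP **116**, and NOT PROVED here («NE9 ⇐ the named binders»; spine PROVED 0∕9).  HONEST DEPENDENCY (cell line, verbatim):
continuum YM on T⁴ ⇐ BetaPertH ∧ nine spine estimates (0/9 proved); BetaPertH ⇐ (D1) ∧ (D4) ∧ CAP+tail; G-an2-4 gates asym,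
D1 and NE2/3/4.  MECHANISM ONLY: NOTHING here constructs Bałaban's functional `C` (= `C_j` of (49) [15] ∕ Eq. (1.3) of [II]),
the operator `H(s(Y₀))`, or the carriers (route R2′ step B2′ = socket C19′, FROZEN under the coordinator ruling e34b3e0c (0));
the quadratic bound `‖C Y‖ ≤ C₂‖Y‖²` ([15] p. 285 ⇐ B7 Prop. 4∕7), the analyticity of `C`, the operator bound `‖H‖ ≤ b =
B₀e^{16κ₁}` ([II] (1.11)) and the two smallness restrictions are HYPOTHESES, exactly as in `B13Contraction113` (GAPS C-B13-02).

WHY THIS LEAF.  `Literature…B13Contraction113` (b13-g5) types [II] p. 5's contraction (1.13) and proves its fixed point analytic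
in ONE complex parameter at a time (Part C∕D `differentiableOn_fixedPoint` ∕ `analytic_fixedPoint_113`, hypothesis `han` quantified
over holomorphic test families), recording in its header: «joint analyticity in the several parameters s(Δ) … one complex parameter at
a time is typed; separate analyticity + the uniform bounds give joint analyticity by Osgood∕Hartogs — [folklore], not formalised».
Generation 37 of this lineage closed that IN THE ABSTRACT (`NE9AnalyticFixedPoint.exists_analyticOnNhd_fixedPt_section`: complex
Banach parameter, no Osgood∕Hartogs).  This leaf closes it ON THE PRINTED INSTANCE and in the form route R2′ consumes: the
solution of (1.13) as ONE analytic map of the pair (A′, H) — [II] p. 5 *"hence the fixed point is an analytic function of A′,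
s(Y₀)"* with both at once (s(Y₀) enters (1.13) only through H(s(Y₀)) and A′).  Route R2′'s composite (B11 Sect. G (174):
𝒜(B) built from D(·) and 𝒜₁(·)) needs exactly this: D as a map analytic JOINTLY in its argument and in the operator data, on a
PRESCRIBED ball, with D(0) = 0 (the `A 0 = 0` clause of `SubstrateComplexBackground.ComplexBackgroundFamily.ofChart`).

WHAT THIS LEAF PROVES (kernel; all [folklore] mechanism over abstract complex Banach spaces `𝒳`, `𝒴`).
(§1) `norm_T_sub_T_le_of_mul_le`: the transplanted (53)–(54) Lipschitz bound `9C₂bε‖X₁ − X₂‖` of `X ↦ C(A′ − HX)` on ANY closed ball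
`‖X‖ ≤ ρ` with `bρ ≤ ε` (B13's `lipschitz_T` is the case `ρ = 4C₂ε²` under `4C₂bε ≤ 1`); this supplies the room `r < r′` that
`exists_analyticOnNhd_fixedPt_section` asks for, with no strict inequality on `R`.
(§2) `eq_zero_and_hasFDerivAt_zero_of_norm_le_mul_sq`: a map with `‖f x‖ ≤ c‖x‖²` near `0` has `f 0 = 0` and Fréchet derivative `0`
at `0` — [15] p. 286 after (55): *"This implies that a power series expansion of D(A′) begins with second order terms"*.
(§3) `exists_analyticOnNhd_solution_113` — THE UNIVERSAL SOLUTION MAP: under `9C₂bε < 1`, `3ε ≤ R`, there is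
`D : 𝒴 × (𝒳 →L[ℂ] 𝒴) → 𝒳`, `AnalyticOnNhd ℂ` on `ball 0 ε ×ˢ ball 0 b`, with `D(A′,H) ∈ closedBall 0 (4C₂ε²)`,
`C(A′ − H·D(A′,H)) = D(A′,H)`, UNIQUE in that ball, `‖D(A′,H)‖ ≤ 4C₂‖A′‖²` ((1.14) = (55) [15], by `bound_114`), `D(0,H) = 0` and
`∂_{A′}D(0,H) = 0`.
(§4) `analyticOnNhd_fixedPoint_113` — THE COROLLARY FOR ANY NORMED PARAMETER SPACE `Ξ` (completeness of `Ξ` NOT needed, unlike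
p248333's direct use): `ξ ↦ (A ξ, H ξ)` analytic on `V` with `‖A ξ‖ < ε`, `‖H ξ‖ ≤ b` ⇒ `ξ ↦ D(A ξ, H ξ)` analytic on `V` with the
same four clauses — B13's `analytic_fixedPoint_113` with «one complex parameter σ ∈ V ⊆ ℂ» replaced by «any ξ», and its `han`
hypothesis replaced by the analyticity of the data.
(§5) `analyticOnNhd_fixedPoint_115` — the Eq. (1.4) ∕ (1.15)–(1.16) twin of `fixedPoint_115` ((C₂, b, ε, H) ↦ (C₄b, 1, bε₃, −id)),
now with an analytic parameter in `A₁ = H₀(s)B′`.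
HONEST CAVEAT (typing): `C`'s analyticity is taken FRÉCHET (`AnalyticOnNhd ℂ C (ball 0 R)`), which is STRONGER than
`B13Contraction113.QuadAnalytic.lineAnalytic` (analytic along complex lines); on the cell's finite-dimensional carriers the printed
«analytic function» ([15] p. 287; B7 Prop. 7) is Fréchet-analytic, and the bridge «line-analytic + locally bounded ⇒ analytic»
(Hartogs∕Osgood; Zorn–Hille in Banach spaces) is NEITHER used NOR claimed here.  DISGUISE TEST: Banach's fixed point + the implicit
function theorem (via `NE9AnalyticFixedPoint`) + Cauchy's estimate (via `B13Contraction113` Part A); no inequality of the series is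
proved; not NE9; 0 def, 0 sorry.

References (TYPES ∕ loci only): [Balaban1988RG2Cluster] T. Bałaban, CMP **116** (1988) 1–22, p. 5 (1.12)–(1.14), p. 6 (1.15)–(1.16);
[Balaban1985Variational] T. Bałaban, CMP **102** (1985) 277–309 (= [15] of [II]), Sect. C pp. 285–287 (49)–(55), Sect. E Prop. 6
pp. 295–296, Sect. G pp. 305–307 (171)–(175) (the three displayed contractions of route R2′); S.-N. Chow, J. K. Hale, *Methods of
Bifurcation Theory* (1982) §2.2 [folklore].  Imports `NE9AnalyticFixedPoint` (hence `B13Contraction113`) ONLY; modifies nothing.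
Value = route-R2′ kernel on the tree's own typing of (1.13), NOT summit progress.
-/

noncomputable section

open scoped Topology NNReal ContDiff
open Metric Set Filter Function Asymptotics

namespace Summit.QuantumFields.BalabanUV.T4Continuum.NE9Contraction113Banach

open Literature.MathematicalPhysics.QuantumFieldTheory.Balaban1983to89.B13Contraction113
open Summit.QuantumFields.BalabanUV.T4Continuum.NE9AnalyticFixedPoint

/-! ## §1 The (53)–(54) Lipschitz bound on any closed ball of radius `ρ` with `bρ ≤ ε` -/

section Lipschitz

variable {𝒳 𝒴 : Type*} [NormedAddCommGroup 𝒳] [NormedSpace ℂ 𝒳] [NormedAddCommGroup 𝒴] [NormedSpace ℂ 𝒴]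
variable {C : 𝒴 → 𝒳} {C₂ R b ε ρ : ℝ} {Hop : 𝒳 →ₗ[ℂ] 𝒴} {A' : 𝒴}

/-- [folklore] **The contraction estimate of (1.13) on a closed ball of any radius `ρ` with `bρ ≤ ε`.**  For `C` with the
quadratic bound and line-analyticity on `‖Y‖ < R` (`QuadAnalytic C C₂ R`), `‖H X‖ ≤ b‖X‖`, `‖A′‖ < ε`, `bρ ≤ ε` and `3ε ≤ R`:
`‖C(A′ − HX₁) − C(A′ − HX₂)‖ ≤ 9C₂bε·‖X₁ − X₂‖` for `‖X₁‖, ‖X₂‖ ≤ ρ` — the Cauchy formula on the discs of radius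
`r = ε(b‖X₁ − X₂‖)⁻¹` around the segment, as in [15] p. 286 (53)–(54); the argument stays in the ball of radius `3ε`.
(B13's `lipschitz_T` = the case `ρ = 4C₂ε²`, `4C₂bε ≤ 1`.)  Proof adapted from `B13Contraction113.lipschitz_T`. -/
theorem norm_T_sub_T_le_of_mul_le (hC : QuadAnalytic C C₂ R) (hC₂ : 0 ≤ C₂) (hb : 0 ≤ b)
    (hHop : ∀ X, ‖Hop X‖ ≤ b * ‖X‖) (hA : ‖A'‖ < ε) (hρ : b * ρ ≤ ε) (hRC : 3 * ε ≤ R)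
    {X₁ X₂ : 𝒳} (h₁ : X₁ ∈ closedBall (0:𝒳) ρ) (h₂ : X₂ ∈ closedBall (0:𝒳) ρ) :
    ‖C (A' - Hop X₁) - C (A' - Hop X₂)‖ ≤ 9 * C₂ * b * ε * ‖X₁ - X₂‖ := by
  -- adapted from `Literature…B13Contraction113.lipschitz_T` (b13-g5): only the source of `‖H X_t‖ ≤ ε` changes
  have hε : 0 < ε := (norm_nonneg _).trans_lt hA
  set δ : 𝒳 := X₁ - X₂ with hδ
  set P : 𝒴 := A' - Hop X₂ with hP
  set Q : 𝒴 := -(Hop δ) with hQ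
  set h : ℂ → 𝒳 := fun ζ => C (P + ζ • Q) with hh
  have hQn : ‖Q‖ ≤ b * ‖δ‖ := by rw [hQ, norm_neg]; exact hHop δ
  have h0 : h 0 = C (A' - Hop X₂) := by simp [hh, hP]
  have h1 : h 1 = C (A' - Hop X₁) := by
    simp only [hh, hP, hQ, hδ, one_smul, map_sub]
    congr 1
    abel
  by_cases hbδ : b * ‖δ‖ = 0
  · have hQ0 : Q = 0 := by
      have : ‖Q‖ ≤ 0 := hQn.trans hbδ.le
      exact norm_le_zero_iff.mp this
    have : h 1 = h 0 := by simp [hh, hQ0]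
    rw [← h1, ← h0, this, sub_self, norm_zero]
    positivity
  have hbδpos : 0 < b * ‖δ‖ := lt_of_le_of_ne (mul_nonneg hb (norm_nonneg _)) (Ne.symm hbδ)
  set r : ℝ := ε / (b * ‖δ‖) with hr
  have hrpos : 0 < r := div_pos hε hbδpos
  have hrQ : r * ‖Q‖ ≤ ε := by
    calc r * ‖Q‖ ≤ r * (b * ‖δ‖) := mul_le_mul_of_nonneg_left hQn hrpos.le
      _ = ε := by rw [hr, div_mul_cancel₀ _ (ne_of_gt hbδpos)]
  -- the segment points lie in the closed ball of radius ρ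
  have hXt : ∀ t : ℝ, t ∈ Icc (0:ℝ) 1 → ‖X₂ + (t : ℂ) • δ‖ ≤ ρ := by
    intro t ht
    have hconv := (convex_closedBall (0:𝒳) ρ) h₂ h₁ (sub_nonneg.mpr ht.2) ht.1 (by ring)
    have heq : (1 - t) • X₂ + t • X₁ = X₂ + (t : ℂ) • δ := by
      rw [hδ, Complex.coe_smul, smul_sub, sub_smul, one_smul]
      abel
    rw [heq, mem_closedBall, dist_zero_right] at hconv
    exact hconv
  -- norm of the argument on the discs around the segment: < 3ε
  have harg : ∀ t : ℝ, t ∈ Icc (0:ℝ) 1 → ∀ z ∈ closedBall (t : ℂ) r, ‖P + z • Q‖ < 3 * ε := by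
    intro t ht z hz
    rw [mem_closedBall, dist_eq_norm] at hz
    have hsplit : P + z • Q = (A' - Hop (X₂ + (t : ℂ) • δ)) + (z - t) • Q := by
      rw [hP, hQ, map_add, map_smul, sub_smul, smul_neg, smul_neg]
      abel
    have hHt : ‖Hop (X₂ + (t : ℂ) • δ)‖ ≤ ε := by
      calc ‖Hop (X₂ + (t : ℂ) • δ)‖ ≤ b * ‖X₂ + (t : ℂ) • δ‖ := hHop _
        _ ≤ b * ρ := mul_le_mul_of_nonneg_left (hXt t ht) hb
        _ ≤ ε := hρ
    calc ‖P + z • Q‖ = ‖(A' - Hop (X₂ + (t : ℂ) • δ)) + (z - t) • Q‖ := by rw [hsplit]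
      _ ≤ ‖A' - Hop (X₂ + (t : ℂ) • δ)‖ + ‖(z - t) • Q‖ := norm_add_le _ _
      _ ≤ (‖A'‖ + ‖Hop (X₂ + (t : ℂ) • δ)‖) + ‖z - (t:ℂ)‖ * ‖Q‖ := by
          rw [norm_smul]; exact add_le_add (norm_sub_le _ _) le_rfl
      _ ≤ (‖A'‖ + ε) + r * ‖Q‖ := by gcongr
      _ < (ε + ε) + ε := by linarith
      _ = 3 * ε := by ring
  have hU : IsOpen {ζ : ℂ | ‖P + ζ • Q‖ < R} :=
    isOpen_lt (continuous_const.add (continuous_id.smul continuous_const)).norm continuous_const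
  have hsub : ∀ t : ℝ, t ∈ Icc (0:ℝ) 1 → closedBall (t : ℂ) r ⊆ {ζ : ℂ | ‖P + ζ • Q‖ < R} :=
    fun t ht z hz => (harg t ht z hz).trans_le hRC
  have hM : ∀ t : ℝ, t ∈ Icc (0:ℝ) 1 → ∀ z ∈ sphere (t : ℂ) r, ‖h z‖ ≤ C₂ * (3 * ε) ^ 2 := by
    intro t ht z hz
    have hz' : z ∈ closedBall (t:ℂ) r := sphere_subset_closedBall hz
    have hlt := harg t ht z hz'
    calc ‖h z‖ = ‖C (P + z • Q)‖ := rfl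
      _ ≤ C₂ * ‖P + z • Q‖ ^ 2 := hC.quad _ (hlt.trans_le hRC)
      _ ≤ C₂ * (3 * ε) ^ 2 :=
          mul_le_mul_of_nonneg_left (pow_le_pow_left₀ (norm_nonneg _) hlt.le 2) hC₂
  have main : ‖h 1 - h 0‖ ≤ C₂ * (3 * ε) ^ 2 / r :=
    norm_sub_le_of_sphere_bound hU (hC.lineAnalytic P Q) hrpos hsub hM
  rw [h1, h0] at main
  calc ‖C (A' - Hop X₁) - C (A' - Hop X₂)‖ ≤ C₂ * (3 * ε) ^ 2 / r := main
    _ = 9 * C₂ * b * ε * ‖δ‖ := by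
        rw [hr]
        field_simp
        ring

end Lipschitz

/-! ## §2 Second-order vanishing at the origin from a quadratic bound -/

section SecondOrder

variable {F G : Type*} [NormedAddCommGroup F] [NormedSpace ℂ F] [NormedAddCommGroup G] [NormedSpace ℂ G]

/-- [folklore] **`‖f x‖ ≤ c‖x‖²` near `0` ⇒ `f 0 = 0` and `Df(0) = 0`** — [15] p. 286 after (55): *"This implies that a power
series expansion of D(A′) begins with second order terms"*.  (`‖x‖²` is `o(‖x‖)`, Mathlib `Asymptotics.isLittleO_norm_pow_id`.) -/
theorem eq_zero_and_hasFDerivAt_zero_of_norm_le_mul_sq {f : F → G} {c ε : ℝ} (hε : 0 < ε)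
    (hf : ∀ x ∈ ball (0:F) ε, ‖f x‖ ≤ c * ‖x‖ ^ 2) :
    f 0 = 0 ∧ HasFDerivAt f (0 : F →L[ℂ] G) 0 := by
  have h0 : f 0 = 0 := by
    have := hf 0 (mem_ball_self hε)
    simpa using this
  refine ⟨h0, ?_⟩
  rw [hasFDerivAt_iff_isLittleO_nhds_zero]
  simp only [zero_add, h0, sub_zero, zero_apply]
  have h1 : f =O[𝓝 (0:F)] fun x => ‖x‖ ^ 2 := by
    refine IsBigO.of_bound c ?_
    filter_upwards [ball_mem_nhds (0:F) hε] with x hx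
    rw [Real.norm_of_nonneg (by positivity)]
    exact hf x hx
  exact h1.trans_isLittleO (isLittleO_norm_pow_id one_lt_two)

end SecondOrder

/-! ## §3 The universal solution map of (1.13), jointly analytic in `(A′, H)` -/

section Universal

variable {𝒳 𝒴 : Type*} [NormedAddCommGroup 𝒳] [NormedSpace ℂ 𝒳] [CompleteSpace 𝒳]
  [NormedAddCommGroup 𝒴] [NormedSpace ℂ 𝒴] [CompleteSpace 𝒴]

omit [CompleteSpace 𝒳] [CompleteSpace 𝒴] in
/-- [folklore] **Fréchet analyticity on the ball gives `QuadAnalytic`** (line-analyticity along every complex line is the composite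
with an affine map). -/
theorem quadAnalytic_of_analyticOnNhd {C : 𝒴 → 𝒳} {C₂ R : ℝ}
    (hquad : ∀ Y : 𝒴, ‖Y‖ < R → ‖C Y‖ ≤ C₂ * ‖Y‖ ^ 2) (hCa : AnalyticOnNhd ℂ C (ball (0:𝒴) R)) :
    QuadAnalytic C C₂ R := by
  refine ⟨hquad, fun P Q => ?_⟩
  have hd : DifferentiableOn ℂ C (ball (0:𝒴) R) := hCa.differentiableOn
  have haff : Differentiable ℂ (fun ζ : ℂ => P + ζ • Q) :=
    (differentiable_const P).add (differentiable_id.smul_const Q)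
  refine hd.comp haff.differentiableOn ?_
  intro ζ hζ
  simpa [mem_ball_zero_iff] using hζ

omit [CompleteSpace 𝒳] [CompleteSpace 𝒴] in
/-- The operator bound `‖H X‖ ≤ b‖X‖` for `H` in the open ball `‖H‖ < b` of `𝒳 →L[ℂ] 𝒴`, in the linear-map form B13's lemmas take. -/
theorem norm_apply_le_of_mem_ball {b : ℝ} {H : 𝒳 →L[ℂ] 𝒴} (hH : H ∈ ball (0 : 𝒳 →L[ℂ] 𝒴) b) (X : 𝒳) :
    ‖(H : 𝒳 →ₗ[ℂ] 𝒴) X‖ ≤ b * ‖X‖ :=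
  (H.le_opNorm X).trans (mul_le_mul_of_nonneg_right (mem_ball_zero_iff.mp hH).le (norm_nonneg X))

/-- [folklore] **THE UNIVERSAL SOLUTION MAP OF (1.13), JOINTLY ANALYTIC IN `(A′, H)`.**  Let `C : 𝒴 → 𝒳` obey
`‖C Y‖ ≤ C₂‖Y‖²` and be analytic on `‖Y‖ < R` (`0 ≤ C₂`), and let `0 ≤ b`, `0 < ε`, `9C₂bε < 1`, `3ε ≤ R` (the contraction condition of
GAPS G-B13-02a and [II] p. 5's radius).  Then there is `D : 𝒴 × (𝒳 →L[ℂ] 𝒴) → 𝒳`, ANALYTIC on `ball 0 ε ×ˢ ball 0 b`, such that for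
every `(A′, H)` there: `D(A′,H) ∈ closedBall 0 (4C₂ε²)`; `C(A′ − H(D(A′,H))) = D(A′,H)` (the fixed point of (1.13)); every solution in
that closed ball equals `D(A′,H)`; `‖D(A′,H)‖ ≤ 4C₂‖A′‖²` ((1.14) ∕ (55) [15]); and for every `H`: `D(0,H) = 0`,
`∂_{A′}D(·,H)(0) = 0` ([15] p. 286: the expansion *"begins with second order terms"*).  [II] p. 5: *"hence the fixed point is an
analytic function of A′, s(Y₀), bounded by 4C₂ε₂²"* — with both arguments at once.  Mechanism: `NE9AnalyticFixedPoint.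
exists_contDiffOn_fixedPt_section` (`n = ω`) on the parameter space `𝒴 × (𝒳 →L[ℂ] 𝒴)` with `r = 4C₂ε² < r′ = r + (ε − br)∕(b+1)`
(§1 gives the Lipschitz constant `9C₂bε` on `‖X‖ ≤ r′` since `br′ ≤ ε`), B13's `mapsTo_T` ∕ `bound_114`, §2. -/
theorem exists_analyticOnNhd_solution_113 {C : 𝒴 → 𝒳} {C₂ R b ε : ℝ}
    (hquad : ∀ Y : 𝒴, ‖Y‖ < R → ‖C Y‖ ≤ C₂ * ‖Y‖ ^ 2) (hCa : AnalyticOnNhd ℂ C (ball (0:𝒴) R))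
    (hC₂ : 0 ≤ C₂) (hb : 0 ≤ b) (hε : 0 < ε) (hq : 9 * C₂ * b * ε < 1) (hRC : 3 * ε ≤ R) :
    ∃ D : 𝒴 × (𝒳 →L[ℂ] 𝒴) → 𝒳,
      AnalyticOnNhd ℂ D (ball (0:𝒴) ε ×ˢ ball (0 : 𝒳 →L[ℂ] 𝒴) b) ∧
      (∀ p ∈ ball (0:𝒴) ε ×ˢ ball (0 : 𝒳 →L[ℂ] 𝒴) b,
        D p ∈ closedBall (0:𝒳) (4 * C₂ * ε ^ 2) ∧ C (p.1 - p.2 (D p)) = D p ∧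
        (∀ X' ∈ closedBall (0:𝒳) (4 * C₂ * ε ^ 2), C (p.1 - p.2 X') = X' → X' = D p) ∧
        ‖D p‖ ≤ 4 * C₂ * ‖p.1‖ ^ 2) ∧
      (∀ H ∈ ball (0 : 𝒳 →L[ℂ] 𝒴) b,
        D (0, H) = 0 ∧ HasFDerivAt (fun A' : 𝒴 => D (A', H)) (0 : 𝒴 →L[ℂ] 𝒳) 0) := by
  have hC : QuadAnalytic C C₂ R := quadAnalytic_of_analyticOnNhd hquad hCa
  -- letters
  set r : ℝ := 4 * C₂ * ε ^ 2 with hr_def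
  have hr : 0 ≤ r := by positivity
  have hq0 : 0 ≤ 9 * C₂ * b * ε := by positivity
  have hR2 : 4 * C₂ * b * ε ≤ 1 := by nlinarith
  have hR2' : 4 * C₂ * b * ε < 1 := by nlinarith
  have hRC2 : 2 * ε ≤ R := by linarith
  have hbr : b * r < ε := by
    have : b * r = (4 * C₂ * b * ε) * ε := by rw [hr_def]; ring
    rw [this]; nlinarith
  set r' : ℝ := r + (ε - b * r) / (b + 1) with hr'_def
  have hb1 : 0 < b + 1 := by linarith
  have hrr' : r < r' := by
    have : 0 < (ε - b * r) / (b + 1) := div_pos (by linarith) hb1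
    linarith
  have hbr' : b * r' ≤ ε := by
    have h1 : b * ((ε - b * r) / (b + 1)) ≤ ε - b * r := by
      rw [mul_div_assoc']
      rw [div_le_iff₀ hb1]
      nlinarith
    calc b * r' = b * r + b * ((ε - b * r) / (b + 1)) := by rw [hr'_def]; ring
      _ ≤ b * r + (ε - b * r) := by linarith
      _ = ε := by ring
  set K : ℝ≥0 := ⟨9 * C₂ * b * ε, hq0⟩ with hK_def
  have hK : (K : ℝ) < 1 := hq
  -- the parameter space and the family
  set U : Set (𝒴 × (𝒳 →L[ℂ] 𝒴)) := ball (0:𝒴) ε ×ˢ ball (0 : 𝒳 →L[ℂ] 𝒴) b with hU_def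
  have hU : IsOpen U := isOpen_ball.prod isOpen_ball
  set T : 𝒴 × (𝒳 →L[ℂ] 𝒴) → 𝒳 → 𝒳 := fun p X => C (p.1 - (p.2 : 𝒳 →ₗ[ℂ] 𝒴) X) with hT_def
  have hA : ∀ p ∈ U, ‖p.1‖ < ε := fun p hp => mem_ball_zero_iff.mp hp.1
  have hHop : ∀ p ∈ U, ∀ X, ‖(p.2 : 𝒳 →ₗ[ℂ] 𝒴) X‖ ≤ b * ‖X‖ := fun p hp X => norm_apply_le_of_mem_ball hp.2 X
  have hmaps : ∀ p ∈ U, MapsTo (T p) (closedBall (0:𝒳) r) (closedBall (0:𝒳) r) := fun p hp =>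
    mapsTo_T hC hC₂ hb (hHop p hp) (hA p hp) hR2 hRC2
  have hlip : ∀ p ∈ U, LipschitzOnWith K (T p) (ball (0:𝒳) r') := by
    intro p hp
    refine LipschitzOnWith.of_dist_le_mul fun X hX Y hY => ?_
    rw [dist_eq_norm, dist_eq_norm]
    exact norm_T_sub_T_le_of_mul_le hC hC₂ hb (hHop p hp) (hA p hp) hbr' hRC (ball_subset_closedBall hX)
      (ball_subset_closedBall hY)
  -- joint analyticity of `(p, X) ↦ T p X` on `U ×ˢ ball 0 r'`
  have hlin : ContDiff ℂ ω (fun q : (𝒴 × (𝒳 →L[ℂ] 𝒴)) × 𝒳 => q.1.1 - q.1.2 q.2) :=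
    (contDiff_fst.comp contDiff_fst).sub ((contDiff_snd.comp contDiff_fst).clm_apply contDiff_snd)
  have hCd : ContDiffOn ℂ ω C (ball (0:𝒴) R) := hCa.contDiffOn_of_completeSpace
  have hT : ContDiffOn ℂ ω (fun q : (𝒴 × (𝒳 →L[ℂ] 𝒴)) × 𝒳 => T q.1 q.2) (U ×ˢ ball (0:𝒳) r') := by
    refine hCd.comp hlin.contDiffOn ?_
    intro q hq
    have hq1 : ‖q.1.1‖ < ε := hA q.1 hq.1
    have hq2 : ‖q.1.2‖ < b := mem_ball_zero_iff.mp hq.1.2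
    have hq3 : ‖q.2‖ < r' := mem_ball_zero_iff.mp hq.2
    rw [mem_ball_zero_iff]
    calc ‖q.1.1 - q.1.2 q.2‖ ≤ ‖q.1.1‖ + ‖q.1.2 q.2‖ := norm_sub_le _ _
      _ ≤ ‖q.1.1‖ + ‖q.1.2‖ * ‖q.2‖ := by gcongr; exact q.1.2.le_opNorm q.2
      _ ≤ ‖q.1.1‖ + b * r' := add_le_add le_rfl (mul_le_mul hq2.le hq3.le (norm_nonneg _) hb)
      _ < ε + ε := by linarith
      _ ≤ R := by linarith
  have hω : (ω : ℕ∞ω) ≠ 0 := by simp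
  obtain ⟨D, hDs, hfix, huniq, -⟩ :=
    exists_contDiffOn_fixedPt_section T hU hr hrr' hK hω hmaps hlip hT
  have hDa : AnalyticOnNhd ℂ D U := fun p hp => ((hDs p hp).contDiffAt (hU.mem_nhds hp)).analyticAt
  have hbd : ∀ p ∈ U, ‖D p‖ ≤ 4 * C₂ * ‖p.1‖ ^ 2 := fun p hp =>
    bound_114 hC hC₂ hb (hHop p hp) (hA p hp) hq hRC (hfix p hp).1 (hfix p hp).2
  refine ⟨D, hDa, fun p hp => ⟨(hfix p hp).1, (hfix p hp).2, fun X' hX' hX'fix => huniq p hp X' hX' hX'fix, hbd p hp⟩,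
    fun H hH => ?_⟩
  -- second-order vanishing at `A′ = 0`
  refine eq_zero_and_hasFDerivAt_zero_of_norm_le_mul_sq (f := fun A' : 𝒴 => D (A', H)) (c := 4 * C₂) hε
    fun A' hA' => ?_
  exact hbd (A', H) ⟨hA', hH⟩

end Universal

/-! ## §4 The corollary for any analytic parametrisation `ξ ↦ (A′_ξ, H_ξ)` -/

section Parametrised

variable {𝒳 𝒴 : Type*} [NormedAddCommGroup 𝒳] [NormedSpace ℂ 𝒳] [CompleteSpace 𝒳]
  [NormedAddCommGroup 𝒴] [NormedSpace ℂ 𝒴] [CompleteSpace 𝒴]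
  {Ξ : Type*} [NormedAddCommGroup Ξ] [NormedSpace ℂ Ξ]

/-- [folklore] **THE (1.13) FIXED POINT IS JOINTLY ANALYTIC IN ANY ANALYTIC PARAMETER** — B13's `analytic_fixedPoint_113` with
the ONE complex parameter `σ ∈ V ⊆ ℂ` replaced by `ξ ∈ V ⊆ Ξ`, `Ξ` ANY complex normed space (no completeness), and the test-family
hypothesis `han` replaced by the analyticity of the data: `H : Ξ → (𝒳 →L[ℂ] 𝒴)` and `A : Ξ → 𝒴` analytic on `V` with `‖H ξ‖ ≤ b`,
`‖A ξ‖ < ε` there, `C` as in §3, `9C₂bε < 1`, `3ε ≤ R`.  Conclusion: an analytic `Xs : Ξ → 𝒳` on `V` with `Xs ξ ∈ closedBall 0 (4C₂ε²)`,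
`C(A ξ − H ξ (Xs ξ)) = Xs ξ`, uniqueness in that ball, `‖Xs ξ‖ ≤ 4C₂‖A ξ‖²`.  ([II] p. 5 «analytic function of A′, s(Y₀)»: take
`ξ = (A′, s(Y₀))` with `H ξ = H(s(Y₀))`, `A ξ = A′`; [15] p. 287 «analytic function of U₀»: put `U₀` in `ξ` too.)  Proof: §3 at the
slightly larger operator radius `b′ = b + (1 − 9C₂bε)∕(9C₂ε + 1)` (still `9C₂b′ε < 1`), composed with `ξ ↦ (A ξ, H ξ)`. -/
theorem analyticOnNhd_fixedPoint_113 {C : 𝒴 → 𝒳} {C₂ R b ε : ℝ}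
    (hquad : ∀ Y : 𝒴, ‖Y‖ < R → ‖C Y‖ ≤ C₂ * ‖Y‖ ^ 2) (hCa : AnalyticOnNhd ℂ C (ball (0:𝒴) R))
    (hC₂ : 0 ≤ C₂) (hb : 0 ≤ b) {V : Set Ξ} {H : Ξ → (𝒳 →L[ℂ] 𝒴)} {A : Ξ → 𝒴}
    (hHa : AnalyticOnNhd ℂ H V) (hAa : AnalyticOnNhd ℂ A V) (hHb : ∀ ξ ∈ V, ‖H ξ‖ ≤ b)
    (hAε : ∀ ξ ∈ V, ‖A ξ‖ < ε) (hq : 9 * C₂ * b * ε < 1) (hRC : 3 * ε ≤ R) :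
    ∃ Xs : Ξ → 𝒳, AnalyticOnNhd ℂ Xs V ∧ ∀ ξ ∈ V,
      Xs ξ ∈ closedBall (0:𝒳) (4 * C₂ * ε ^ 2) ∧ C (A ξ - H ξ (Xs ξ)) = Xs ξ ∧
      (∀ X' ∈ closedBall (0:𝒳) (4 * C₂ * ε ^ 2), C (A ξ - H ξ X') = X' → X' = Xs ξ) ∧
      ‖Xs ξ‖ ≤ 4 * C₂ * ‖A ξ‖ ^ 2 := by
  by_cases hVne : V.Nonempty
  swap
  · refine ⟨fun _ => 0, ?_, fun ξ hξ => (hVne ⟨ξ, hξ⟩).elim⟩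
    rw [Set.not_nonempty_iff_eq_empty.mp hVne]
    exact fun ξ hξ => hξ.elim
  obtain ⟨ξ₀, hξ₀⟩ := hVne
  have hε : 0 < ε := (norm_nonneg _).trans_lt (hAε ξ₀ hξ₀)
  -- a slightly larger operator radius keeping the contraction condition
  have hq0 : 0 ≤ 9 * C₂ * ε := by positivity
  set b' : ℝ := b + (1 - 9 * C₂ * b * ε) / (9 * C₂ * ε + 1) with hb'_def
  have hpos : 0 < 9 * C₂ * ε + 1 := by linarith
  have hbb' : b < b' := by
    have : 0 < (1 - 9 * C₂ * b * ε) / (9 * C₂ * ε + 1) := div_pos (by linarith) hpos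
    linarith
  have hb' : 0 ≤ b' := hb.trans hbb'.le
  have hq' : 9 * C₂ * b' * ε < 1 := by
    have h1 : 9 * C₂ * ε * ((1 - 9 * C₂ * b * ε) / (9 * C₂ * ε + 1)) < 1 - 9 * C₂ * b * ε := by
      rw [mul_div_assoc', div_lt_iff₀ hpos]
      nlinarith
    calc 9 * C₂ * b' * ε = 9 * C₂ * b * ε + 9 * C₂ * ε * ((1 - 9 * C₂ * b * ε) / (9 * C₂ * ε + 1)) := by
          rw [hb'_def]; ring
      _ < 9 * C₂ * b * ε + (1 - 9 * C₂ * b * ε) := by linarith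
      _ = 1 := by ring
  obtain ⟨D, hDa, hD, -⟩ := exists_analyticOnNhd_solution_113 hquad hCa hC₂ hb' hε hq' hRC
  have hmem : ∀ ξ ∈ V, (A ξ, H ξ) ∈ ball (0:𝒴) ε ×ˢ ball (0 : 𝒳 →L[ℂ] 𝒴) b' := fun ξ hξ =>
    ⟨mem_ball_zero_iff.mpr (hAε ξ hξ), mem_ball_zero_iff.mpr ((hHb ξ hξ).trans_lt hbb')⟩
  refine ⟨fun ξ => D (A ξ, H ξ), hDa.comp₂ hAa hHa hmem, fun ξ hξ => ?_⟩
  obtain ⟨h1, h2, h3, h4⟩ := hD (A ξ, H ξ) (hmem ξ hξ)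
  exact ⟨h1, h2, h3, h4⟩

/-! ## §5 The Eq. (1.4) ∕ (1.15)–(1.16) twin with an analytic parameter -/

/-- [folklore] **THE Eq. (1.4) ∕ (1.15)–(1.16) TWIN WITH AN ANALYTIC PARAMETER** (B13's `fixedPoint_115`, which has none): for
`W : 𝒴 → 𝒴` with `‖W Y‖ ≤ C₄b‖Y‖²` and analytic on `‖Y‖ < R` (`W := G̃(δV∕δA′)(H, ·)` of [II] p. 6, constant `C₄b` from (98) [15] and
`‖G̃‖ ≤ b`), `0 < b`, and an ANALYTIC datum `A₁ : Ξ → 𝒴` on `V` (`A₁ = H₀(s(Y₀))B′`) with `‖A₁ ξ‖ ≤ b·nB`, `nB < ε₃`, under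
`9C₄b²ε₃ < 1` and `3bε₃ ≤ R`: an analytic `As : Ξ → 𝒴` on `V` with `As ξ ∈ closedBall 0 (4C₄b³ε₃²)` (the printed radius),
`W(A₁ ξ + As ξ) = As ξ`, uniqueness there, and (1.16) `‖As ξ‖ ≤ 4C₄b³nB²`.  Instance of `analyticOnNhd_fixedPoint_113` with
`(C₂, b, ε, H) ↦ (C₄b, 1, bε₃, −id)`. -/
theorem analyticOnNhd_fixedPoint_115 {W : 𝒴 → 𝒴} {C₄ b R ε₃ nB : ℝ}
    (hquad : ∀ Y : 𝒴, ‖Y‖ < R → ‖W Y‖ ≤ C₄ * b * ‖Y‖ ^ 2) (hWa : AnalyticOnNhd ℂ W (ball (0:𝒴) R))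
    (hC₄ : 0 ≤ C₄) (hb : 0 < b) {V : Set Ξ} {A₁ : Ξ → 𝒴} (hA₁a : AnalyticOnNhd ℂ A₁ V)
    (hA₁ : ∀ ξ ∈ V, ‖A₁ ξ‖ ≤ b * nB) (hB : nB < ε₃) (hq : 9 * C₄ * b ^ 2 * ε₃ < 1)
    (hRC : 3 * (b * ε₃) ≤ R) :
    ∃ As : Ξ → 𝒴, AnalyticOnNhd ℂ As V ∧ ∀ ξ ∈ V,
      As ξ ∈ closedBall (0:𝒴) (4 * C₄ * b ^ 3 * ε₃ ^ 2) ∧ W (A₁ ξ + As ξ) = As ξ ∧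
      (∀ A' ∈ closedBall (0:𝒴) (4 * C₄ * b ^ 3 * ε₃ ^ 2), W (A₁ ξ + A') = A' → A' = As ξ) ∧
      ‖As ξ‖ ≤ 4 * C₄ * b ^ 3 * nB ^ 2 := by
  -- the instance `(C₂, b, ε, H) ↦ (C₄ b, 1, b ε₃, −id)`
  have hC₂ : 0 ≤ C₄ * b := mul_nonneg hC₄ hb.le
  have hq' : 9 * (C₄ * b) * 1 * (b * ε₃) < 1 := by nlinarith
  have hHa : AnalyticOnNhd ℂ (fun _ : Ξ => -(ContinuousLinearMap.id ℂ 𝒴)) V := analyticOnNhd_const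
  have hHb : ∀ ξ ∈ V, ‖-(ContinuousLinearMap.id ℂ 𝒴)‖ ≤ (1:ℝ) := fun _ _ => by
    rw [norm_neg]; exact ContinuousLinearMap.norm_id_le
  have hAε : ∀ ξ ∈ V, ‖A₁ ξ‖ < b * ε₃ := fun ξ hξ => (hA₁ ξ hξ).trans_lt (mul_lt_mul_of_pos_left hB hb)
  obtain ⟨As, hAs, hcl⟩ := analyticOnNhd_fixedPoint_113 (Ξ := Ξ) hquad hWa hC₂ zero_le_one hHa hA₁a hHb hAε hq' hRC
  have hrad : 4 * (C₄ * b) * (b * ε₃) ^ 2 = 4 * C₄ * b ^ 3 * ε₃ ^ 2 := by ring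
  refine ⟨As, hAs, fun ξ hξ => ?_⟩
  obtain ⟨h1, h2, h3, h4⟩ := hcl ξ hξ
  rw [hrad] at h1 h3
  have hsub : ∀ X : 𝒴, A₁ ξ - (-(ContinuousLinearMap.id ℂ 𝒴)) X = A₁ ξ + X := fun X => by simp
  refine ⟨h1, by simpa only [hsub] using h2, fun A' hA' hfix => h3 A' hA' (by simpa only [hsub] using hfix), ?_⟩
  calc ‖As ξ‖ ≤ 4 * (C₄ * b) * ‖A₁ ξ‖ ^ 2 := h4
    _ ≤ 4 * (C₄ * b) * (b * nB) ^ 2 := by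
        exact mul_le_mul_of_nonneg_left (pow_le_pow_left₀ (norm_nonneg _) (hA₁ ξ hξ) 2) (by positivity)
    _ = 4 * C₄ * b ^ 3 * nB ^ 2 := by ring

end Parametrised

end Summit.QuantumFields.BalabanUV.T4Continuum.NE9Contraction113Banach

end
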